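import Literature.MathematicalPhysics.QuantumFieldTheory.Balaban1983to89.Node00.BgSchemeOfRecord
import Literature.MathematicalPhysics.QuantumFieldTheory.Balaban1983to89.B11Claim309UAnalytic
import HarnessLib

/-!
# [B11] Prop. 9 p.309 ∕ [B15] Prop. 1: THE COMPLEX EDITION OF THE SCHEME OF RECORD — the data `B`, `𝔄 = H₁B`, the fixed point `𝒜` and the
# background field `exp(iη(𝒜 + 𝔄))U₀` of the record's Prop. 6 scheme AS FUNCTIONS OF A COMPLEX (`Gᶜ`-valued) DATUM, their `rfl` reality
# bridges to `bgSchemeOfRecord`, and their ℂ-analyticity modulo the displayed regime ∕ analyticity letters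
# — OURS (definitional + compositions of LANDED analyticity theorems; file 1 of M2-ℂ; no inequality of Bałaban)

Cell `pub-ymgap`, unit `pub-ymgap-node00-def-Y` (g37; owner∕custodian of the `OpsY` instance at the record; Node00 definition lane;
count-neutral, `--supports stmt-QuantumFields-27238`).  ★★★ director-ym №551 (N1): «the complex edition of the scheme of record» = the
Node00∕Literature half of the P0-ℂ letter (Theorems-side letter `P0HolExtAtRecord`: unit `ym-nodeO-def-1`; consumer spec PTA-1
`P0C-CONSUMER-SPEC-v1` (P1)–(P3)).

PRINT.  [B11] Sect. G p.307: «all the operators and functions above … are analytic functions of these configurations [with values in the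
complexified algebra]»; Prop. 9 p.309: the solution of (116) «is an analytic function … also of the external gauge field configuration», and
the minimising configuration «has an extension to an analytic function of `Gᶜ`-valued configurations»; [B15] Prop. 1 (last clause) ∕ (189):
the same extension in the block variable `𝕍 = exp(iB′)V`.  Files 3d′–3g′ typed the REAL scheme at a displayed background `U₀`: datum
`V : GaugeField (F.P K) k (SU N)` ↦ `B(V)` (20) ↦ `𝔄(V) = H₁B(V)` (103) ↦ `𝒜(V) = solA 𝔊 0 W J ε₄ 𝔄(V)` (116) ↦ `exp(iη·ev(𝒜 + 𝔄))U₀` (15),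
with `𝔊`, `W`, `J` INDEPENDENT of `V` (they are data at `U₀`).  Hence the complex edition in the datum variable is obtained by letting the ONE
`V`-dependent letter, (20)'s `B(V)(c) = (1/i) log(V(c)(Ū^kU₀)(c)⋆)`, act on COMPLEX level-`k` bond matrices `Z` (3e′'s `logOver` is already
written over `PBond → Matrix (Fin N) (Fin N) ℂ`), and composing with the landed linear `H₁`, the parameter-analytic fixed point
(`B11Claim309UAnalytic.analyticOnNhd_solA`: «the fixed point of a uniformly contracting analytic family is analytic in the parameter») and
3e′'s entire chart `expOver U₀`.

CONTENTS (all at a displayed REAL background `U₀`; the complex variable is the level-`k` DATUM `Z : PBond (F.P K) k → Matrix (Fin N) (Fin N) ℂ`).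
* §1 `BOfRecordC` — (20)'s `B` on complex data; `BOfRecordC (coeField V) = BOfRecord V` (`rfl`); analytic on the log-polydisc
  `‖Z(c)(Ū^kU₀)(c)⋆ − 1‖ < 1` (lit ✓`analyticAt_logOver_apply`).
* §2 `frakAOfRecordAtBg128C` — (103)'s `𝔄 = H₁B` on complex data (slot (c) `H₁` of 3f′); `rfl` reality; analytic (CLM ∘ §1).
* §3 `solOfRecordC` — (116)'s selected fixed point `𝒜` as a function of the complex datum; `solOfRecordC (coeField V) = (bgSchemeOfRecord …).sol V`
  (`rfl`); ★ `analyticOnNhd_solOfRecordC`: ONE CALL of `analyticOnNhd_solA` with the data `𝔊`, `Λ := 0`, `W`, `J` constant in the parameter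
  and `𝔄 = §2` — hypotheses = the uniform regime (`Regime 𝔊 0 W B₀ 0 C₄ a₃ j a𝔄 ε₄`, `‖J‖ ≤ j`, `‖𝔄ᶜ(Z)‖ < a𝔄` on `𝒪`), the log-polydisc on `𝒪`,
  and Prop. 4's analyticity of `W` on `{‖Y‖ < a₃}` (token `WAnalyticTok`); corollary `…_of_regimeTok` reading the first two off 3a's `RegimeTok`.
* §4 `bgFieldOfRecordC` — THE COMPLEX BACKGROUND FIELD «`U = exp(iηA′)U₀`, `A′ = 𝒜 + 𝔄`» on complex data (3e′'s `expOver U₀` at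
  `η·ev(𝒜ᶜ(Z) + 𝔄ᶜ(Z))`); reality: `= expOver U₀ (S.ev (S.sol V + S.𝔄 V))` (`rfl`), hence `= ↑(S.chartCfg V b)` on the `SU(N)` bonds (3g′
  ✓`bgSchemeOfRecord_coe_chartCfg`); analytic on `𝒪` (entire chart ∘ CLM ∘ §3).
* §5 `bgFieldOfFineC` — the same read as a function of a complex FINE field `𝐔` through the holomorphic `k`-fold average `Z = Ū^k_h(𝐔)`
  (lit ✓`B15AveragingHolomorphic.iterMh`; reality under the small-field guard via 3e′ ✓`iterMh_coeField_of_smallBelow`; analytic at every `𝐔` in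
  the (0.4) polydisc whose average lies in `𝒪`, lit ✓`analyticAt_iterMh_of_polydisc`) — the socket for a consumer whose complex variable is the
  fine field (PTA-1 (P1)'s pair `(𝐔, 𝐉)`); which of §4∕§5∕§6 is consumed is the consumer's choice.
* §6 `avgBgFieldOfRecordC i` — the depth-`i` holomorphic average `Ū^i_h(Ûᶜ(Z))` of §4 (the complex twin of the next step's DATUM «`V^{(i)} = Ū^i(U)`» built
  from the level-`k` scheme's background; the Theorems side uses it at scheme level `k + 1`, depth `i = k`); reality on `ChartSUTok` data within the
  guard (`= ↑(Ū^i(chart image))`); analytic on `𝒪` under the (0.4) polydisc for the image (§4 ∘ lit ✓`analyticAt_iterMh_of_polydisc`).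

HONEST LABELS.  Definitions, `rfl` bridges, and analyticity theorems that are COMPOSITIONS of landed ones; the regime (117)–(121), the bound on `J`
(28), the smallness of `𝔄ᶜ` on `𝒪` (46)∕(103), the log-polydisc and Prop. 4's analyticity of `W` are HYPOTHESES (displayed, never asserted), and
the `k`-UNIFORMITY of the constants is the consumer row's quantifier order, not this file's.  NOT here: the complex PAIR∕cover∕integer-twin
carriers and the letters `TC`, `TY`, `TZY` of `P0HolExtAtRecord` (Theorems side), det-one COVARIANCE of `bgFieldOfRecordC` (needs the gauge
covariance of every slot), (1.21)'s localisation∕decay, the spectral letters, and any `∃` over scheme data.  No `sorry`, no new axiom, no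
instance ∕ notation.  Nothing here is a claim about the Yang–Mills mass gap (`Summit.QuantumFields`): finite torus, fixed `ε`; nothing
continuum ∕ OS ∕ Clay.
-/

noncomputable section

open scoped Matrix Matrix.Norms.L2Operator InnerProductSpace ComplexConjugate Topology

namespace Literature.MathematicalPhysics.QuantumFieldTheory.Balaban1983to89.Node00

open T4Continuum BlockAveraging
open NormedSpace (exp)
open B15AveragingHolomorphic (iterMh loopMh)
open B15AveragingAnalytic (analyticAt_iterMh_of_polydisc)
open B11Eq103H1Complex (BondL2K SiteL2K)
open B11Eq115Space (Space115 NegSize NegSup JetSup levWeight)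
open B11Eq174Chart (Regime solA)
open B11Claim309UAnalytic (analyticOnNhd_solA)

/-! ## §1. (20)'s `B` on complex data -/

section Generic

variable (F : T4Family) (N : ℕ) [NeZero N] {K : ℕ} (k : ℕ)

variable (K) in
/-- ★ **(20)'s `B` ON COMPLEX LEVEL-`k` DATA**: `Bᶜ(Z)(c) = (1/i) log( Z(c) · (Ū^kU₀)(c)⋆ )` for an arbitrary complex bond-matrix field `Z` (print's
`Gᶜ`-valued `𝕍 = exp(iB′)V`), read into the size `|·|_{(−0)}` of (115)-type — 3e′'s `logOver` over the averaged background, un-restricted to `SU(N)`.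
[cite: Balaban1985Variational, (20) p.281, Sect. G p.307, Prop. 9 p.309; Balaban1988Hilbert, Prop. 1 p.13] -/
def BOfRecordC (U₀ : GaugeField (F.P K) 0 (SU N)) (levB : PBond (F.P K) k → ℕ) (Z : PBond (F.P K) k → Matrix (Fin N) (Fin N) ℂ) :
    NegSize (F.L : ℝ) ((F.P K).eta k) levB 0 (Matrix (Fin N) (Fin N) ℂ) :=
  (NegSup.equiv _ _).symm (logOver (coeField (Averaging.iter (avOfRecord F N K) k U₀)) Z)

/-- Unfolding of `BOfRecordC` at a bond. [cite: Balaban1985Variational, (20) p.281 (bookkeeping)] -/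
theorem BOfRecordC_apply (U₀ : GaugeField (F.P K) 0 (SU N)) (levB : PBond (F.P K) k → ℕ) (Z : PBond (F.P K) k → Matrix (Fin N) (Fin N) ℂ)
    (c : PBond (F.P K) k) :
    NegSup.equiv _ _ (BOfRecordC F N K k U₀ levB Z) c =
      (Complex.I⁻¹ : ℂ) • MatrixLog.mlog (Z c * star (Averaging.iter (avOfRecord F N K) k U₀ c : Matrix (Fin N) (Fin N) ℂ)) := rfl

/-- ★ **REALITY**: on an `SU(N)`-valued datum the complex edition IS 3e′'s `BOfRecord` (`rfl`). [cite: Balaban1985Variational, (20) p.281, Prop. 9 p.309] -/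
theorem BOfRecordC_coeField (U₀ : GaugeField (F.P K) 0 (SU N)) (levB : PBond (F.P K) k → ℕ) (V : GaugeField (F.P K) k (SU N)) :
    BOfRecordC F N K k U₀ levB (coeField V) = BOfRecord F N K k U₀ levB V := rfl

/-- `Bᶜ` vanishes at the averaged background `↑(Ū^kU₀)` (3e′ `BOfRecord_self`). [cite: Balaban1985Variational, (3) p.278, (20) p.281] -/
theorem BOfRecordC_self (U₀ : GaugeField (F.P K) 0 (SU N)) (levB : PBond (F.P K) k → ℕ) :
    BOfRecordC F N K k U₀ levB (coeField (Averaging.iter (avOfRecord F N K) k U₀)) = 0 := by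
  rw [BOfRecordC_coeField, BOfRecord_self]

/-- ★ **`Bᶜ` IS ℂ-ANALYTIC ON THE LOG-POLYDISC** `‖Z(c)(Ū^kU₀)(c)⋆ − 1‖ < 1` (bondwise `(1/i)·log`, lit ✓`analyticAt_logOver_apply`, through the linear
isometry onto the size). [cite: Balaban1985Variational, Sect. G p.307, Prop. 9 p.309; Balaban1985Averaging, (21) p.21] -/
theorem analyticAt_BOfRecordC [Fact (0 < (F.L : ℝ))] [Fact (0 < (F.P K).eta k)] (U₀ : GaugeField (F.P K) 0 (SU N)) (levB : PBond (F.P K) k → ℕ)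
    {Z : PBond (F.P K) k → Matrix (Fin N) (Fin N) ℂ}
    (hlog : ∀ c : PBond (F.P K) k, ‖Z c * star (Averaging.iter (avOfRecord F N K) k U₀ c : Matrix (Fin N) (Fin N) ℂ) - 1‖ < 1) :
    AnalyticAt ℂ (BOfRecordC F N K k U₀ levB) Z := by
  have hg : AnalyticAt ℂ (fun Y : PBond (F.P K) k → Matrix (Fin N) (Fin N) ℂ => logOver (coeField (Averaging.iter (avOfRecord F N K) k U₀)) Y) Z :=
    analyticAt_pi_iff.2 fun c => analyticAt_logOver_apply (coeField (Averaging.iter (avOfRecord F N K) k U₀)) c (hlog c)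
  exact ((NegSup.continuousLinearEquiv ℂ (V := Matrix (Fin N) (Fin N) ℂ) (levWeight (F.L : ℝ) ((F.P K).eta k) levB 0)).symm.analyticAt _).comp hg

/-- `Bᶜ` is ℂ-analytic at every `SU(N)`-valued datum within log-distance `1` of the averaged background, in particular at `↑(Ū^kU₀)` itself.
[cite: Balaban1985Variational, Sect. G p.307, (20) p.281] -/
theorem analyticAt_BOfRecordC_self [Fact (0 < (F.L : ℝ))] [Fact (0 < (F.P K).eta k)] (U₀ : GaugeField (F.P K) 0 (SU N))
    (levB : PBond (F.P K) k → ℕ) :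
    AnalyticAt ℂ (BOfRecordC F N K k U₀ levB) (coeField (Averaging.iter (avOfRecord F N K) k U₀)) :=
  analyticAt_BOfRecordC F N k U₀ levB fun c => by
    rw [coeField_apply, coe_mul_star_coe_SU, sub_self, norm_zero]
    exact one_pos

end Generic

section Record

variable (F : T4Family) (N : ℕ) [NeZero N] (K : ℕ) (k : ℕ) (Ω : ℕ → Set (Site (F.P K) 0)) (U₀ : GaugeField (F.P K) 0 (SU N))
variable [Fact (0 < (F.L : ℝ))] [Fact (0 < (F.P K).eta k)] [Fact (0 < c0Rec F K k)] [Fact (∀ c, 0 < wBRec F K k c)]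

/-! ## §2. (103)'s `𝔄 = H₁B` on complex data (slot (c)) -/

/-- ★ **(103)'s `𝔄 = H₁B` ON COMPLEX DATA, SLOT (c)**: `𝔄ᶜ(Z) = H₁(U₀)(Bᶜ(Z))` with 3f′'s `H1OfRecordAtBg128` (the scheme of record's `𝔄`-slot,
un-restricted to `SU(N)`-valued data). [cite: Balaban1985Variational, (103) p.293, (20) p.281, Prop. 9 p.309] -/
def frakAOfRecordAtBg128C (levB : PBond (F.P K) k → ℕ)
    (Gp : SiteL2K ℂ (F.P K).d (fun _ => (F.P K).sitesPerDir 0) (c0Rec F K k) (WRec N) →ₗ[ℂ]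
      SiteL2K ℂ (F.P K).d (fun _ => (F.P K).sitesPerDir 0) (c0Rec F K k) (WRec N))
    (Δ2 : BondL2K ℂ (F.P K).d (fun _ => (F.P K).sitesPerDir 0) (c0Rec F K k) (WRec N) →ₗ[ℂ]
      BondL2K ℂ (F.P K).d (fun _ => (F.P K).sitesPerDir 0) (c0Rec F K k) (WRec N)) (a : ℝ)
    (hposπ : ∀ x, x ≠ 0 → 0 < RCLike.re ⟪x, laplaceAOfRecordAt F N k U₀ (hessOpOfRecord128 F N k U₀ Gp (QflatOfRecord F N k) Δ2)
      (QOfRecord F N k U₀) (QflatOfRecord F N k) a x⟫_ℂ)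
    (hQ : Function.Surjective (QOfRecord F N k U₀)) (Z : PBond (F.P K) k → Matrix (Fin N) (Fin N) ℂ) : Space115Lit F N K k Ω U₀ :=
  H1OfRecordAtBg128 F N K k Ω U₀ levB Gp Δ2 a hposπ hQ (BOfRecordC F N K k U₀ levB Z)

section Slots

variable (levB : PBond (F.P K) k → ℕ)
  (Gp : SiteL2K ℂ (F.P K).d (fun _ => (F.P K).sitesPerDir 0) (c0Rec F K k) (WRec N) →ₗ[ℂ]
    SiteL2K ℂ (F.P K).d (fun _ => (F.P K).sitesPerDir 0) (c0Rec F K k) (WRec N))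
  (Δ2 : BondL2K ℂ (F.P K).d (fun _ => (F.P K).sitesPerDir 0) (c0Rec F K k) (WRec N) →ₗ[ℂ]
    BondL2K ℂ (F.P K).d (fun _ => (F.P K).sitesPerDir 0) (c0Rec F K k) (WRec N)) (a : ℝ)
  (hposπ : ∀ x, x ≠ 0 → 0 < RCLike.re ⟪x, laplaceAOfRecordAt F N k U₀ (hessOpOfRecord128 F N k U₀ Gp (QflatOfRecord F N k) Δ2)
    (QOfRecord F N k U₀) (QflatOfRecord F N k) a x⟫_ℂ)
  (hposb : ∀ x, x ≠ 0 → 0 < RCLike.re ⟪x, laplaceAOfRecord F N k U₀ (QOfRecord F N k U₀) (QflatOfRecord F N k) a x⟫_ℂ)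
  (hQ : Function.Surjective (QOfRecord F N k U₀))

/-- ★ **REALITY**: on an `SU(N)`-valued datum `𝔄ᶜ` IS 3f′'s `frakAOfRecordAtBg128` (`rfl`). [cite: Balaban1985Variational, (103) p.293, Prop. 9 p.309] -/
theorem frakAOfRecordAtBg128C_coeField (V : GaugeField (F.P K) k (SU N)) :
    frakAOfRecordAtBg128C F N K k Ω U₀ levB Gp Δ2 a hposπ hQ (coeField V) = frakAOfRecordAtBg128 F N K k Ω U₀ levB Gp Δ2 a hposπ hQ V := rfl

/-- `𝔄ᶜ` vanishes at the averaged background (3f′ `frakAOfRecordAtBg128_self`). [cite: Balaban1985Variational, (20) p.281, (103) p.293] -/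
theorem frakAOfRecordAtBg128C_self :
    frakAOfRecordAtBg128C F N K k Ω U₀ levB Gp Δ2 a hposπ hQ (coeField (Averaging.iter (avOfRecord F N K) k U₀)) = 0 := by
  rw [frakAOfRecordAtBg128C_coeField]
  exact frakAOfRecordAtBg128_self F N K k Ω U₀ levB Gp Δ2 a hposπ hQ

/-- ★ **`𝔄ᶜ` IS ℂ-ANALYTIC ON THE LOG-POLYDISC** (a continuous linear `H₁` after §1). [cite: Balaban1985Variational, Sect. G p.307, (103) p.293, Prop. 9 p.309] -/
theorem analyticAt_frakAOfRecordAtBg128C {Z : PBond (F.P K) k → Matrix (Fin N) (Fin N) ℂ}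
    (hlog : ∀ c : PBond (F.P K) k, ‖Z c * star (Averaging.iter (avOfRecord F N K) k U₀ c : Matrix (Fin N) (Fin N) ℂ) - 1‖ < 1) :
    AnalyticAt ℂ (frakAOfRecordAtBg128C F N K k Ω U₀ levB Gp Δ2 a hposπ hQ) Z :=
  ((H1OfRecordAtBg128 F N K k Ω U₀ levB Gp Δ2 a hposπ hQ).analyticAt _).comp (analyticAt_BOfRecordC F N k U₀ levB hlog)

/-! ## §3. (116)'s fixed point `𝒜` as a function of the complex datum -/

/-- ★★ **THE FIXED POINT OF (116) ON COMPLEX DATA**: `𝒜ᶜ(Z) = solA 𝔊(U₀) 0 W(U₀) J(U₀) ε₄ 𝔄ᶜ(Z)` — the scheme of record's selected solution of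
`X = −𝔊J − 𝔊W(X + 𝔄)` with the shift `𝔄` evaluated on the complex datum (the data `𝔊`, `W`, `J` live at `U₀` and do not see the datum).
[cite: Balaban1985Variational, Prop. 6 (116) p.295, Prop. 9 p.309] -/
def solOfRecordC (εC ε₄ : ℝ) (Z : PBond (F.P K) k → Matrix (Fin N) (Fin N) ℂ) : Space115Lit F N K k Ω U₀ :=
  solA (frakGOfRecordAtBg128 F N K k Ω U₀ Gp Δ2 a hposπ hQ) 0 (WOfRecordAt F N K k Ω U₀ levB a hposb hQ εC Gp) (JOfRecordAtBg F N K k Ω U₀) ε₄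
    (frakAOfRecordAtBg128C F N K k Ω U₀ levB Gp Δ2 a hposπ hQ Z)

/-- ★ **REALITY**: on an `SU(N)`-valued datum `𝒜ᶜ` IS the scheme of record's `sol` (`rfl`; any `dom` and displayed constants).
[cite: Balaban1985Variational, Prop. 6 (116) p.295, Prop. 9 p.309] -/
theorem solOfRecordC_coeField (dom : Set (GaugeField (F.P K) k (SU N))) (εC B₀ C₄ a₃ j a𝔄 ε₄ : ℝ) (V : GaugeField (F.P K) k (SU N)) :
    solOfRecordC F N K k Ω U₀ levB Gp Δ2 a hposπ hposb hQ εC ε₄ (coeField V) =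
      (bgSchemeOfRecord F N K k Ω U₀ dom levB Gp Δ2 a hposπ hposb hQ εC B₀ C₄ a₃ j a𝔄 ε₄).sol V := rfl

/-- **TOKEN (Prop. 4's analyticity of `W`)** — «(δ/δA′)V … is analytic» on the ball `{‖Y‖ < a₃}` for the scheme of record's `W` (the joint-analyticity
premise of `analyticOnNhd_solA` for parameter-independent `W`; `Regime.quad` records only LINE analyticity).  A named hypothesis, never asserted.
[cite: Balaban1985Variational, Prop. 4 p.292, (80) p.290, p.309] -/
def WAnalyticTok (εC a₃ : ℝ) : Prop :=
  AnalyticOnNhd ℂ (WOfRecordAt F N K k Ω U₀ levB a hposb hQ εC Gp) {Y : Space115Lit F N K k Ω U₀ | ‖Y‖ < a₃}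

/-- ★★★ **«THE SOLUTION IS AN ANALYTIC FUNCTION OF THE `Gᶜ`-VALUED DATUM»** (Prop. 9 at the record, datum variable): on an OPEN set `𝒪` of complex
level-`k` data inside the log-polydisc on which `‖𝔄ᶜ‖ < a𝔄`, under the regime of Prop. 6 for the data at `U₀` (`Regime 𝔊 0 W B₀ 0 C₄ a₃ j a𝔄 ε₄`,
`‖J‖ ≤ j`) and Prop. 4's analyticity of `W`, the fixed point `Z ↦ 𝒜ᶜ(Z)` is ℂ-analytic on `𝒪` — ONE call of lit ✓`analyticOnNhd_solA` («the fixed point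
of a uniformly contracting analytic family is analytic in the parameter») with `𝔊`, `Λ = 0`, `W`, `J` constant in the parameter.
[cite: Balaban1985Variational, Prop. 9 p.309, p.309, Prop. 6 (116)–(121) p.295] -/
theorem analyticOnNhd_solOfRecordC {εC B₀ C₄ a₃ j a𝔄 ε₄ : ℝ} {𝒪 : Set (PBond (F.P K) k → Matrix (Fin N) (Fin N) ℂ)} (h𝒪 : IsOpen 𝒪)
    (R : Regime (frakGOfRecordAtBg128 F N K k Ω U₀ Gp Δ2 a hposπ hQ) (0 : Space115Lit F N K k Ω U₀ →L[ℂ] Space115Lit F N K k Ω U₀)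
      (WOfRecordAt F N K k Ω U₀ levB a hposb hQ εC Gp) B₀ 0 C₄ a₃ j a𝔄 ε₄)
    (hJ : ‖JOfRecordAtBg F N K k Ω U₀‖ ≤ j) (h𝔄 : ∀ Z ∈ 𝒪, ‖frakAOfRecordAtBg128C F N K k Ω U₀ levB Gp Δ2 a hposπ hQ Z‖ < a𝔄)
    (hlog : ∀ Z ∈ 𝒪, ∀ c : PBond (F.P K) k, ‖Z c * star (Averaging.iter (avOfRecord F N K) k U₀ c : Matrix (Fin N) (Fin N) ℂ) - 1‖ < 1)
    (hW : WAnalyticTok F N K k Ω U₀ levB Gp a hposb hQ εC a₃) :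
    AnalyticOnNhd ℂ (solOfRecordC F N K k Ω U₀ levB Gp Δ2 a hposπ hposb hQ εC ε₄) 𝒪 := by
  have hWp : AnalyticOnNhd ℂ (fun p : (PBond (F.P K) k → Matrix (Fin N) (Fin N) ℂ) × Space115Lit F N K k Ω U₀ =>
      WOfRecordAt F N K k Ω U₀ levB a hposb hQ εC Gp p.2) (𝒪 ×ˢ {Y : Space115Lit F N K k Ω U₀ | ‖Y‖ < a₃}) :=
    fun p hp => (hW p.2 (Set.mem_prod.1 hp).2).comp_of_eq analyticAt_snd rfl
  exact analyticOnNhd_solA (𝒢 := fun _ => frakGOfRecordAtBg128 F N K k Ω U₀ Gp Δ2 a hposπ hQ)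
    (Λ := fun _ => (0 : Space115Lit F N K k Ω U₀ →L[ℂ] Space115Lit F N K k Ω U₀))
    (W := fun _ => WOfRecordAt F N K k Ω U₀ levB a hposb hQ εC Gp) (J := fun _ => JOfRecordAtBg F N K k Ω U₀)
    (𝔄 := frakAOfRecordAtBg128C F N K k Ω U₀ levB Gp Δ2 a hposπ hQ) h𝒪 (fun _ _ => R) (fun _ _ => hJ) h𝔄
    (fun _ _ => analyticAt_const) (fun _ _ => analyticAt_const) hWp (fun _ _ => analyticAt_const)
    (fun Z hZ => analyticAt_frakAOfRecordAtBg128C F N K k Ω U₀ levB Gp Δ2 a hposπ hQ (hlog Z hZ))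

/-- The same with the regime and the bound on `J` read off 3a's `RegimeTok` of the scheme of record at ANY datum of a nonempty domain (the data do not
see the datum). [cite: Balaban1985Variational, Prop. 6 (117)–(121) p.295, Prop. 9 p.309] -/
theorem analyticOnNhd_solOfRecordC_of_regimeTok {dom : Set (GaugeField (F.P K) k (SU N))} {εC B₀ C₄ a₃ j a𝔄 ε₄ : ℝ}
    (hT : (bgSchemeOfRecord F N K k Ω U₀ dom levB Gp Δ2 a hposπ hposb hQ εC B₀ C₄ a₃ j a𝔄 ε₄).RegimeTok) {V₀ : GaugeField (F.P K) k (SU N)}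
    (hV₀ : V₀ ∈ dom) {𝒪 : Set (PBond (F.P K) k → Matrix (Fin N) (Fin N) ℂ)} (h𝒪 : IsOpen 𝒪)
    (h𝔄 : ∀ Z ∈ 𝒪, ‖frakAOfRecordAtBg128C F N K k Ω U₀ levB Gp Δ2 a hposπ hQ Z‖ < a𝔄)
    (hlog : ∀ Z ∈ 𝒪, ∀ c : PBond (F.P K) k, ‖Z c * star (Averaging.iter (avOfRecord F N K) k U₀ c : Matrix (Fin N) (Fin N) ℂ) - 1‖ < 1)
    (hW : WAnalyticTok F N K k Ω U₀ levB Gp a hposb hQ εC a₃) :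
    AnalyticOnNhd ℂ (solOfRecordC F N K k Ω U₀ levB Gp Δ2 a hposπ hposb hQ εC ε₄) 𝒪 :=
  analyticOnNhd_solOfRecordC F N K k Ω U₀ levB Gp Δ2 a hposπ hposb hQ h𝒪 (hT V₀ hV₀).1 (hT V₀ hV₀).2.1 h𝔄 hlog hW

/-! ## §4. The complex background field `exp(iη(𝒜ᶜ + 𝔄ᶜ))U₀` -/

/-- ★★ **THE COMPLEX BACKGROUND FIELD OF RECORD**: `Ûᶜ(Z) = exp(iη·ev(𝒜ᶜ(Z) + 𝔄ᶜ(Z)))·U₀` bondwise — «U = U′U₀, U′ = exp(iηA′)», `A′ = 𝒜 + 𝔄`, with the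
fixed point and the shift evaluated on the COMPLEX datum; values in `Gᶜ = GL(N, ℂ)`-matrices (no retraction to `SU(N)`): print's «extension of the
minimising configuration to an analytic function of `Gᶜ`-valued configurations». [cite: Balaban1985Variational, (15) p.280, (19) p.281, (112) p.294,
Prop. 9 p.309; Balaban1988Hilbert, Prop. 1 p.13] -/
def bgFieldOfRecordC (εC ε₄ : ℝ) (Z : PBond (F.P K) k → Matrix (Fin N) (Fin N) ℂ) : PBond (F.P K) 0 → Matrix (Fin N) (Fin N) ℂ :=
  expOver U₀ (((((F.P K).eta k : ℂ)) • evLit F N K k Ω U₀)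
    (solOfRecordC F N K k Ω U₀ levB Gp Δ2 a hposπ hposb hQ εC ε₄ Z + frakAOfRecordAtBg128C F N K k Ω U₀ levB Gp Δ2 a hposπ hQ Z))

/-- Unfolding on a bond: `Ûᶜ(Z)(b) = exp(i·(η·ev(𝒜ᶜ(Z) + 𝔄ᶜ(Z)))(b)) · U₀(b)`. [cite: Balaban1985Variational, (15) p.280 (bookkeeping)] -/
theorem bgFieldOfRecordC_apply (εC ε₄ : ℝ) (Z : PBond (F.P K) k → Matrix (Fin N) (Fin N) ℂ) (b : PBond (F.P K) 0) :
    bgFieldOfRecordC F N K k Ω U₀ levB Gp Δ2 a hposπ hposb hQ εC ε₄ Z b =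
      exp (Complex.I • ((((F.P K).eta k : ℂ)) • evLit F N K k Ω U₀)
        (solOfRecordC F N K k Ω U₀ levB Gp Δ2 a hposπ hposb hQ εC ε₄ Z + frakAOfRecordAtBg128C F N K k Ω U₀ levB Gp Δ2 a hposπ hQ Z) b)
        * (U₀ b : Matrix (Fin N) (Fin N) ℂ) := rfl

/-- ★ **REALITY (matrices)**: on an `SU(N)`-valued datum the complex background field IS 3e′'s chart `expOver U₀` at the scheme of record's exponent
`ev(𝒜(V) + 𝔄(V))` (`rfl`). [cite: Balaban1985Variational, (15) p.280, Prop. 6 p.295, Prop. 9 p.309] -/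
theorem bgFieldOfRecordC_coeField (dom : Set (GaugeField (F.P K) k (SU N))) (εC B₀ C₄ a₃ j a𝔄 ε₄ : ℝ) (V : GaugeField (F.P K) k (SU N)) :
    bgFieldOfRecordC F N K k Ω U₀ levB Gp Δ2 a hposπ hposb hQ εC ε₄ (coeField V) =
      expOver U₀ ((bgSchemeOfRecord F N K k Ω U₀ dom levB Gp Δ2 a hposπ hposb hQ εC B₀ C₄ a₃ j a𝔄 ε₄).ev
        ((bgSchemeOfRecord F N K k Ω U₀ dom levB Gp Δ2 a hposπ hposb hQ εC B₀ C₄ a₃ j a𝔄 ε₄).sol V +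
          (bgSchemeOfRecord F N K k Ω U₀ dom levB Gp Δ2 a hposπ hposb hQ εC B₀ C₄ a₃ j a𝔄 ε₄).𝔄 V)) := rfl

/-- ★★ **REALITY (`SU(N)`)**: on an `SU(N)`-valued datum and a bond where the exponent is `SU(N)`-valued (3a's `ChartSUTok` bonds) the complex background
field IS (the matrix of) the scheme of record's chart image of the fixed point — the real minimiser's letter (3g′ ✓`bgSchemeOfRecord_coe_chartCfg`).
[cite: Balaban1985Variational, (15) p.280, Prop. 6 p.295, Prop. 9 p.309] -/
theorem bgFieldOfRecordC_coeField_eq_coe_chartCfg (dom : Set (GaugeField (F.P K) k (SU N))) (εC B₀ C₄ a₃ j a𝔄 ε₄ : ℝ)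
    {V : GaugeField (F.P K) k (SU N)} {b : PBond (F.P K) 0}
    (h : (bgSchemeOfRecord F N K k Ω U₀ dom levB Gp Δ2 a hposπ hposb hQ εC B₀ C₄ a₃ j a𝔄 ε₄).expo V b ∈ Matrix.specialUnitaryGroup (Fin N) ℂ) :
    bgFieldOfRecordC F N K k Ω U₀ levB Gp Δ2 a hposπ hposb hQ εC ε₄ (coeField V) b =
      (((bgSchemeOfRecord F N K k Ω U₀ dom levB Gp Δ2 a hposπ hposb hQ εC B₀ C₄ a₃ j a𝔄 ε₄).chartCfg V b : SU N) : Matrix (Fin N) (Fin N) ℂ) := by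
  rw [bgSchemeOfRecord_coe_chartCfg F N K k Ω U₀ dom levB Gp Δ2 a hposπ hposb hQ εC B₀ C₄ a₃ j a𝔄 ε₄ h]
  rfl

/-- ★★★ **THE COMPLEX BACKGROUND FIELD IS ℂ-ANALYTIC ON `𝒪`** (the entire chart `expOver U₀` after the linear presentation `η·ev` after §3 + §2) — Prop. 9's
«extension to an analytic function of `Gᶜ`-valued configurations» at the record, modulo the displayed regime ∕ analyticity letters.
[cite: Balaban1985Variational, Prop. 9 p.309, Sect. G p.307, (15) p.280; Balaban1988Hilbert, Prop. 1 p.13] -/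
theorem analyticOnNhd_bgFieldOfRecordC {εC B₀ C₄ a₃ j a𝔄 ε₄ : ℝ} {𝒪 : Set (PBond (F.P K) k → Matrix (Fin N) (Fin N) ℂ)} (h𝒪 : IsOpen 𝒪)
    (R : Regime (frakGOfRecordAtBg128 F N K k Ω U₀ Gp Δ2 a hposπ hQ) (0 : Space115Lit F N K k Ω U₀ →L[ℂ] Space115Lit F N K k Ω U₀)
      (WOfRecordAt F N K k Ω U₀ levB a hposb hQ εC Gp) B₀ 0 C₄ a₃ j a𝔄 ε₄)
    (hJ : ‖JOfRecordAtBg F N K k Ω U₀‖ ≤ j) (h𝔄 : ∀ Z ∈ 𝒪, ‖frakAOfRecordAtBg128C F N K k Ω U₀ levB Gp Δ2 a hposπ hQ Z‖ < a𝔄)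
    (hlog : ∀ Z ∈ 𝒪, ∀ c : PBond (F.P K) k, ‖Z c * star (Averaging.iter (avOfRecord F N K) k U₀ c : Matrix (Fin N) (Fin N) ℂ) - 1‖ < 1)
    (hW : WAnalyticTok F N K k Ω U₀ levB Gp a hposb hQ εC a₃) :
    AnalyticOnNhd ℂ (bgFieldOfRecordC F N K k Ω U₀ levB Gp Δ2 a hposπ hposb hQ εC ε₄) 𝒪 := fun Z hZ => by
  have hsum : AnalyticAt ℂ (fun Y => solOfRecordC F N K k Ω U₀ levB Gp Δ2 a hposπ hposb hQ εC ε₄ Y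
      + frakAOfRecordAtBg128C F N K k Ω U₀ levB Gp Δ2 a hposπ hQ Y) Z :=
    (analyticOnNhd_solOfRecordC F N K k Ω U₀ levB Gp Δ2 a hposπ hposb hQ h𝒪 R hJ h𝔄 hlog hW Z hZ).add
      (analyticAt_frakAOfRecordAtBg128C F N K k Ω U₀ levB Gp Δ2 a hposπ hQ (hlog Z hZ))
  have hev : AnalyticAt ℂ (fun Y => ((((F.P K).eta k : ℂ)) • evLit F N K k Ω U₀)
      (solOfRecordC F N K k Ω U₀ levB Gp Δ2 a hposπ hposb hQ εC ε₄ Y + frakAOfRecordAtBg128C F N K k Ω U₀ levB Gp Δ2 a hposπ hQ Y)) Z :=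
    ((LinearMap.toContinuousLinearMap ((((F.P K).eta k : ℂ)) • evLit F N K k Ω U₀)).analyticAt _).comp hsum
  exact (analyticAt_expOver U₀ _).comp hev

/-! ## §5. The same as a function of a complex FINE field through the holomorphic average -/

/-- ★ **THE COMPLEX BACKGROUND FIELD AS A FUNCTION OF A COMPLEX FINE FIELD**: `𝐔 ↦ Ûᶜ(Ū^k_h(𝐔))` — §4 precomposed with the holomorphic `k`-fold average
of record `iterMh k` (the T-operation's reading: the `k`-th density's background depends on the fine field through its block datum `V_k = Ū^kU`).
[cite: Balaban1987RG1, (0.21) p.256, (1.15) p.263; Balaban1985Variational, Prop. 9 p.309; Balaban1985Averaging, (26) p.22] -/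
def bgFieldOfFineC (εC ε₄ : ℝ) (Uc : PBond (F.P K) 0 → Matrix (Fin N) (Fin N) ℂ) : PBond (F.P K) 0 → Matrix (Fin N) (Fin N) ℂ :=
  bgFieldOfRecordC F N K k Ω U₀ levB Gp Δ2 a hposπ hposb hQ εC ε₄ (iterMh k Uc)

/-- ★ **REALITY**: on an `SU(N)`-valued fine field `U` within the small-field guard below `k` the holomorphic average is the genuine one, so
`bgFieldOfFineC (↑U) = Ûᶜ(↑(Ū^kU))` = §4's real reading at the datum `Ū^kU` (3e′ ✓`iterMh_coeField_of_smallBelow`).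
[cite: Balaban1987RG1, (0.4) p.253, (0.21) p.256; Balaban1985Variational, Prop. 9 p.309] -/
theorem bgFieldOfFineC_coeField (εC ε₄ : ℝ) {U : GaugeField (F.P K) 0 (SU N)} (hU : SmallBelow (avOfRecord F N K) k U) :
    bgFieldOfFineC F N K k Ω U₀ levB Gp Δ2 a hposπ hposb hQ εC ε₄ (coeField U) =
      bgFieldOfRecordC F N K k Ω U₀ levB Gp Δ2 a hposπ hposb hQ εC ε₄ (coeField (Averaging.iter (avOfRecord F N K) k U)) := by
  rw [bgFieldOfFineC, iterMh_coeField_of_smallBelow F N k U hU]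

/-- ★★ **ANALYTICITY IN THE FINE FIELD**: at a complex fine field `𝐔` whose iterated loop matrices below `k` lie in the (0.4) polydisc `‖W − 1‖ < 1` and whose
holomorphic average lies in `𝒪`, `bgFieldOfFineC` is ℂ-analytic (§4 ∘ lit ✓`analyticAt_iterMh_of_polydisc`). [cite: Balaban1985Variational, Prop. 9 p.309;
Balaban1985Averaging, (21) p.21, (26) p.22; Balaban1987RG1, (0.4) p.253] -/
theorem analyticAt_bgFieldOfFineC {εC B₀ C₄ a₃ j a𝔄 ε₄ : ℝ} {𝒪 : Set (PBond (F.P K) k → Matrix (Fin N) (Fin N) ℂ)} (h𝒪 : IsOpen 𝒪)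
    (R : Regime (frakGOfRecordAtBg128 F N K k Ω U₀ Gp Δ2 a hposπ hQ) (0 : Space115Lit F N K k Ω U₀ →L[ℂ] Space115Lit F N K k Ω U₀)
      (WOfRecordAt F N K k Ω U₀ levB a hposb hQ εC Gp) B₀ 0 C₄ a₃ j a𝔄 ε₄)
    (hJ : ‖JOfRecordAtBg F N K k Ω U₀‖ ≤ j) (h𝔄 : ∀ Z ∈ 𝒪, ‖frakAOfRecordAtBg128C F N K k Ω U₀ levB Gp Δ2 a hposπ hQ Z‖ < a𝔄)
    (hlog : ∀ Z ∈ 𝒪, ∀ c : PBond (F.P K) k, ‖Z c * star (Averaging.iter (avOfRecord F N K) k U₀ c : Matrix (Fin N) (Fin N) ℂ) - 1‖ < 1)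
    (hW : WAnalyticTok F N K k Ω U₀ levB Gp a hposb hQ εC a₃) {Uc : PBond (F.P K) 0 → Matrix (Fin N) (Fin N) ℂ}
    (hpoly : ∀ j', j' < k → ∀ (c : PBond (F.P K) (j' + 1)) (i : Idx (F.P K)), ‖loopMh (iterMh j' Uc) c i - 1‖ < 1) (hmem : iterMh k Uc ∈ 𝒪) :
    AnalyticAt ℂ (bgFieldOfFineC F N K k Ω U₀ levB Gp Δ2 a hposπ hposb hQ εC ε₄) Uc :=
  (analyticOnNhd_bgFieldOfRecordC F N K k Ω U₀ levB Gp Δ2 a hposπ hposb hQ h𝒪 R hJ h𝔄 hlog hW _ hmem).comp (analyticAt_iterMh_of_polydisc k hpoly)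

/-! ## §6. The holomorphic average of the complex background field (the next step's complex datum) -/

/-- ★ **THE DEPTH-`i` HOLOMORPHIC AVERAGE OF THE COMPLEX BACKGROUND FIELD**: `Z ↦ Ū^i_h(Ûᶜ(Z))` — §4 followed by the holomorphic `i`-fold average of record
(lit ✓`iterMh i`): the complex twin of the datum «`V^{(i)} = Ū^i(U)`» of a later step computed from the level-`k` scheme's background (the Theorems side reads
it at scheme level `k + 1`, depth `i = k`). [cite: Balaban1987RG1, (0.21) p.256, (1.15) p.263; Balaban1985Variational, Prop. 9 p.309; Balaban1985Averaging, (26) p.22] -/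
def avgBgFieldOfRecordC (εC ε₄ : ℝ) (i : ℕ) (Z : PBond (F.P K) k → Matrix (Fin N) (Fin N) ℂ) : PBond (F.P K) i → Matrix (Fin N) (Fin N) ℂ :=
  iterMh i (bgFieldOfRecordC F N K k Ω U₀ levB Gp Δ2 a hposπ hposb hQ εC ε₄ Z)

/-- ★ **REALITY**: on an `SU(N)`-valued datum whose exponent is `SU(N)`-valued on every bond (3a's `ChartSUTok` at `V`) and whose chart image obeys the
small-field guard below `i`, the depth-`i` holomorphic average of the complex background field IS (the matrix field of) the genuine average `Ū^i` of the
scheme of record's chart image of the fixed point. [cite: Balaban1987RG1, (0.4) p.253, (0.21) p.256; Balaban1985Variational, (15) p.280, Prop. 9 p.309] -/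
theorem avgBgFieldOfRecordC_coeField (dom : Set (GaugeField (F.P K) k (SU N))) (εC B₀ C₄ a₃ j a𝔄 ε₄ : ℝ) (i : ℕ) {V : GaugeField (F.P K) k (SU N)}
    (hSU : ∀ b : PBond (F.P K) 0,
      (bgSchemeOfRecord F N K k Ω U₀ dom levB Gp Δ2 a hposπ hposb hQ εC B₀ C₄ a₃ j a𝔄 ε₄).expo V b ∈ Matrix.specialUnitaryGroup (Fin N) ℂ)
    (hguard : SmallBelow (avOfRecord F N K) i ((bgSchemeOfRecord F N K k Ω U₀ dom levB Gp Δ2 a hposπ hposb hQ εC B₀ C₄ a₃ j a𝔄 ε₄).chartCfg V)) :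
    avgBgFieldOfRecordC F N K k Ω U₀ levB Gp Δ2 a hposπ hposb hQ εC ε₄ i (coeField V) =
      coeField (Averaging.iter (avOfRecord F N K) i ((bgSchemeOfRecord F N K k Ω U₀ dom levB Gp Δ2 a hposπ hposb hQ εC B₀ C₄ a₃ j a𝔄 ε₄).chartCfg V)) := by
  have hcoe : bgFieldOfRecordC F N K k Ω U₀ levB Gp Δ2 a hposπ hposb hQ εC ε₄ (coeField V) =
      coeField ((bgSchemeOfRecord F N K k Ω U₀ dom levB Gp Δ2 a hposπ hposb hQ εC B₀ C₄ a₃ j a𝔄 ε₄).chartCfg V) :=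
    funext fun b => by
      rw [bgFieldOfRecordC_coeField_eq_coe_chartCfg F N K k Ω U₀ levB Gp Δ2 a hposπ hposb hQ dom εC B₀ C₄ a₃ j a𝔄 ε₄ (hSU b), coeField_apply]
  rw [avgBgFieldOfRecordC, hcoe, iterMh_coeField_of_smallBelow F N i _ hguard]

/-- ★★ **THE HOLOMORPHIC AVERAGE OF THE COMPLEX BACKGROUND FIELD IS ℂ-ANALYTIC** at every `Z ∈ 𝒪` whose complex background field has its iterated loop matrices
below depth `i` in the (0.4) polydisc (§4 ∘ lit ✓`analyticAt_iterMh_of_polydisc`). [cite: Balaban1985Variational, Prop. 9 p.309; Balaban1985Averaging, (21) p.21,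
(26) p.22; Balaban1987RG1, (0.4) p.253] -/
theorem analyticAt_avgBgFieldOfRecordC {εC B₀ C₄ a₃ j a𝔄 ε₄ : ℝ} {𝒪 : Set (PBond (F.P K) k → Matrix (Fin N) (Fin N) ℂ)} (h𝒪 : IsOpen 𝒪)
    (R : Regime (frakGOfRecordAtBg128 F N K k Ω U₀ Gp Δ2 a hposπ hQ) (0 : Space115Lit F N K k Ω U₀ →L[ℂ] Space115Lit F N K k Ω U₀)
      (WOfRecordAt F N K k Ω U₀ levB a hposb hQ εC Gp) B₀ 0 C₄ a₃ j a𝔄 ε₄)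
    (hJ : ‖JOfRecordAtBg F N K k Ω U₀‖ ≤ j) (h𝔄 : ∀ Z ∈ 𝒪, ‖frakAOfRecordAtBg128C F N K k Ω U₀ levB Gp Δ2 a hposπ hQ Z‖ < a𝔄)
    (hlog : ∀ Z ∈ 𝒪, ∀ c : PBond (F.P K) k, ‖Z c * star (Averaging.iter (avOfRecord F N K) k U₀ c : Matrix (Fin N) (Fin N) ℂ) - 1‖ < 1)
    (hW : WAnalyticTok F N K k Ω U₀ levB Gp a hposb hQ εC a₃) (i : ℕ) {Z : PBond (F.P K) k → Matrix (Fin N) (Fin N) ℂ} (hZ : Z ∈ 𝒪)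
    (hpoly : ∀ j', j' < i → ∀ (c : PBond (F.P K) (j' + 1)) (ι : Idx (F.P K)),
      ‖loopMh (iterMh j' (bgFieldOfRecordC F N K k Ω U₀ levB Gp Δ2 a hposπ hposb hQ εC ε₄ Z)) c ι - 1‖ < 1) :
    AnalyticAt ℂ (avgBgFieldOfRecordC F N K k Ω U₀ levB Gp Δ2 a hposπ hposb hQ εC ε₄ i) Z :=
  (analyticAt_iterMh_of_polydisc i hpoly).comp (analyticOnNhd_bgFieldOfRecordC F N K k Ω U₀ levB Gp Δ2 a hposπ hposb hQ h𝒪 R hJ h𝔄 hlog hW Z hZ)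

end Slots

end Record

end Literature.MathematicalPhysics.QuantumFieldTheory.Balaban1983to89.Node00
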